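import Literature.Computability.Complexity.DiscreteTomography
import Literature.Computability.Complexity.OneInThreeSAT
import HarnessLib

/-!
# The two renderings of 2D-X-RAY coincide; one complexity leaf for the whole barrier entry

Two decompositions of the barrier entry
`Literature/Barriers/ValiantsHypothesis/KroneckerPositivityHardness.lean` vendored Fischer–Ikenmeyer's
Problem 5 (2D-X-RAY, after Gardner–Gritzmann–Prangenberg 1999) independently:

* `Literature.Computability.Complexity.TWODXRAY` with the fact `GGP1999_twoDXRayNPHard`
  (`DiscreteTomographyHardness.lean`, the Kronecker side; split further in `OneInThreeSAT.lean` into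
  `Schaefer1978_oneInThreeSAT_NPHard` — discharge proposed as `OneInThreeSATMachine.lean` — and the
  circuit board `GGP1999_circuitBoard : ONEIN3SAT ≤ₚ TWODXRAY`);
* `Literature.Computability.Complexity.Tomography.TWODXRAY` with the fact
  `Tomography.GardnerGritzmannPrangenberg1999_twoDXRay_NPHard` (`DiscreteTomography.lean`, the
  plethysm side).

Both are the `toLanguage` image, under the SAME encoding (`unaryEncodingNat.listBool` on each of
the three lists, paired by `pairBool`), of the same set of yes-instances, written once with
`S ⊆ layer r` and pointwise marginals (`getD · 0`) and once with `∀ p ∈ P, coordSum p = r` and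
marginals as functions (`listFn`). This file PROVES the two languages equal (`TWODXRAY_eq`) and hence
the two named facts equivalent (`Tomography.twoDXRay_NPHard_iff_GGP1999`), so that the single remaining
complexity leaf `GGP1999_circuitBoard` serves both halves of the barrier
(`Tomography.twoDXRay_NPHard_of`). Nothing new is asserted.

## References

* [FischerIkenmeyer2020] N. Fischer, C. Ikenmeyer, Comput. Complexity 29 (2020) 8, §6 (Problem 5).
* [GardnerGritzmann1999] R. J. Gardner, P. Gritzmann, in: Herman–Kuba (eds.), *Discrete
  Tomography* (1999), Thm. 4.4.3–4.4.4.
-/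

namespace Literature.Computability.Complexity

open _root_.Computability
open scoped Notation

/-- The plethysm-side marginal `Tomography.xMarginal` is the combinatorics-library marginal
(same definition). [folklore] -/
theorem Tomography.xMarginal_eq (P : Finset Tomography.Point) :
    Tomography.xMarginal P = Literature.Combinatorics.Enumerative.Tomography.xMarginal P := rfl

/-- Likewise for `Y`. [folklore] -/
theorem Tomography.yMarginal_eq (P : Finset Tomography.Point) :
    Tomography.yMarginal P = Literature.Combinatorics.Enumerative.Tomography.yMarginal P := rfl

/-- Likewise for `Z`. [folklore] -/
theorem Tomography.zMarginal_eq (P : Finset Tomography.Point) :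
    Tomography.zMarginal P = Literature.Combinatorics.Enumerative.Tomography.zMarginal P := rfl

/-- `∀ p ∈ P, coordSum p = r` is `P ⊆ layer r`. [folklore] -/
theorem Tomography.forall_coordSum_eq_iff (P : Finset Tomography.Point) (r : ℕ) :
    (∀ p ∈ P, Tomography.coordSum p = r) ↔ P ⊆ Literature.Combinatorics.Enumerative.Tomography.layer r := by
  refine forall₂_congr fun p _ => ?_
  rw [Literature.Combinatorics.Enumerative.Tomography.mem_layer]
  rfl

/-- **The two sets of yes-instances of 2D-X-RAY coincide.** [cite: FischerIkenmeyer2020, §6 (Problem 5)] -/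
theorem twoDXRaySet_eq : Tomography.twoDXRaySet = twoDXRaySet := by
  ext I
  simp only [Tomography.twoDXRaySet, twoDXRaySet, Set.mem_setOf_eq, Tomography.forall_coordSum_eq_iff,
    Tomography.xMarginal_eq, Tomography.yMarginal_eq, Tomography.zMarginal_eq, funext_iff, Tomography.listFn]

/-- **The two languages `TWODXRAY` coincide** (same yes-instances, same unary encoding).
[cite: FischerIkenmeyer2020, §6 (Problem 5)] -/
theorem TWODXRAY_eq : Tomography.TWODXRAY = TWODXRAY := by
  rw [Tomography.TWODXRAY, TWODXRAY, twoDXRaySet_eq]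

/-- **The two Gardner–Gritzmann–Prangenberg facts are the same statement.**
[cite: GardnerGritzmann1999, Thm. 4.4.4] -/
theorem Tomography.twoDXRay_NPHard_iff_GGP1999 :
    Tomography.GardnerGritzmannPrangenberg1999_twoDXRay_NPHard ↔ GGP1999_twoDXRayNPHard := by
  rw [Tomography.GardnerGritzmannPrangenberg1999_twoDXRay_NPHard, GGP1999_twoDXRayNPHard, TWODXRAY_eq]

/-- Hence the plethysm-side fact, too, follows from 1-IN-3-SAT hardness and the circuit board
(`GGP1999_twoDXRayNPHard_of`). [cite: GardnerGritzmann1999, Thm. 4.4.3 (proof)] -/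
theorem Tomography.twoDXRay_NPHard_of (h₁ : Schaefer1978_oneInThreeSAT_NPHard) (h₂ : GGP1999_circuitBoard) :
    Tomography.GardnerGritzmannPrangenberg1999_twoDXRay_NPHard :=
  Tomography.twoDXRay_NPHard_iff_GGP1999.2 (GGP1999_twoDXRayNPHard_of h₁ h₂)

/-- And anything Karp-reducible from the plethysm-side `Tomography.TWODXRAY` is reducible from
`TWODXRAY` (the languages are equal). [folklore] -/
theorem karpReducible_of_tomography_TWODXRAY {L : Language Bool} (h : Tomography.TWODXRAY ≤ₚ L) :
    TWODXRAY ≤ₚ L := by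
  rwa [TWODXRAY_eq] at h

end Literature.Computability.Complexity
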